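import Summits.Ventures.HodgeRepro2.T5SU11FibrationCartan
import Summits.Ventures.HodgeRepro2.T5SU11OneParameter

/-!
# Bi-`K`-invariant functions and the spherical integration formula `∫_G f dg = 2π ∫_0^∞ f(a_t) sinh t cosh t dt`

A function `f` on `SU(1,1)` is BI-`K`-INVARIANT (`f (rot u · g · rot v) = f g` for all `u, v`) iff it is
a function of the Cartan parameter: by the Cartan decomposition `g = rot u · a_t · rot v`, `t ≥ 0`
(`T5SU11Cartan.exists_cartan`), `f g = f (a_t)` with `sinh t = |g₀₁|`, i.e.
`f g = f (a_{arsinh |g₀₁|})` (`biRotInvariant_eq`). The section of the fibration at the point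
`tanh t · e^{iθ}` of the disc is a `K`-conjugate of `a_t`: `s(tanh t · u²) = rot u · a_t · rot u⁻¹`
(`sec_tanh_mul_sq`, `sec_tanh_exp`), so in Rühl's coordinates
(`T5SU11FibrationCartan.integral_eq_cartan`) the integrand of a bi-`K`-invariant `f` is constant
in both angles and **`c • ∫_G f dμ = 2π • ∫_0^∞ (sinh t cosh t) • f(a_t) dt = π • ∫_0^∞ sinh(2t) • f(a_t) dt`**
for every Haar measure `μ` of `SU(1,1)` and every `μ`-integrable bi-`K`-invariant `f`, with
`c = haarScalarFactor (nu haarCircle) μ > 0` (`integral_biRotInvariant`, `integral_biRotInvariant'`;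
`c = 1` for `μ = nu haarCircle`, `integral_nu_biRotInvariant`) — the classical spherical
integration formula `dg = sinh η dη` up to the normalisation of `η = 2t`. Nothing is claimed about (N).

Blind lane: Mathlib + the HodgeRepro2 prefix only; no sorry; axioms ⊆ {propext, Classical.choice,
Quot.sound}.
-/

namespace Summit.Ventures.HodgeRepro2.T5SU11SphericalIntegral

open MeasureTheory MeasureTheory.Measure Metric Set Complex
open T5PoincareDensity T5PoincareMeasure T5SU11Unimodular T5SU11Fibration T5SU11FibrationHaar
  T5SU11FibrationCartan T5HaarCircle T5SU11Cartan T5SU11OneParameter T5BergmanCoefficient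
open scoped ENNReal NNReal Real

/-! ### Bi-`K`-invariant functions are functions of the Cartan parameter -/

/-- `|g₀₁| = sinh t` for `g = rot u · a_t · rot v` with `t ≥ 0`. -/
lemma norm_mat_zero_one_cartan (u v : Circle) {t : ℝ} (ht : 0 ≤ t) :
    ‖mat (rot u * hyp t * rot v) 0 1‖ = Real.sinh t := by
  rw [mat_rot_mul_hyp_mul_rot]
  show ‖(u : ℂ) * (starRingEnd ℂ) (v : ℂ) * (Real.sinh t : ℂ)‖ = Real.sinh t
  rw [norm_mul, norm_mul, Circle.norm_coe, Complex.norm_conj, Circle.norm_coe, one_mul, one_mul,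
    Complex.norm_real, Real.norm_eq_abs, abs_of_nonneg (Real.sinh_nonneg_iff.mpr ht)]

/-- **A bi-`K`-invariant function is a function of the Cartan parameter**:
`f g = f (a_{arsinh |g₀₁|})`. -/
theorem biRotInvariant_eq {E : Type*} {f : SU11 → E}
    (hf : ∀ (u v : Circle) (g : SU11), f (rot u * g * rot v) = f g) (g : SU11) :
    f g = f (hyp (Real.arsinh ‖mat g 0 1‖)) := by
  obtain ⟨u, v, t, ht, hg⟩ := exists_cartan g
  have h1 : ‖mat g 0 1‖ = Real.sinh t := by rw [hg]; exact norm_mat_zero_one_cartan u v ht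
  rw [h1, Real.arsinh_sinh, hg, hf]

/-! ### The section at `tanh t · e^{iθ}` is a `K`-conjugate of `a_t` -/

/-- `r (tanh t · w) = cosh t` for `|w| = 1`. -/
lemma rad_tanh_mul (t : ℝ) (w : Circle) : rad ((Real.tanh t : ℂ) * (w : ℂ)) = Real.cosh t := by
  have hb : (Real.tanh t : ℂ) * (w : ℂ) ∈ ball (0 : ℂ) 1 := by
    rw [mem_ball_zero_iff, norm_mul, Circle.norm_coe, mul_one, Complex.norm_real, Real.norm_eq_abs]
    exact Real.abs_tanh_lt_one t
  have hc := Real.cosh_pos t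
  have hsq : 1 - Complex.normSq ((Real.tanh t : ℂ) * (w : ℂ)) = (Real.cosh t)⁻¹ ^ 2 := by
    rw [map_mul, Complex.normSq_ofReal, Complex.normSq_eq_norm_sq, Circle.norm_coe, one_pow, mul_one,
      Real.tanh_eq_sinh_div_cosh, div_mul_div_comm, one_sub_div (by positivity),
      show Real.cosh t * Real.cosh t - Real.sinh t * Real.sinh t = 1 by
        linear_combination Real.cosh_sq t, one_div, inv_pow, sq]
  unfold rad
  rw [clamp_of_mem_ball hb, hsq, Real.sqrt_sq (inv_pos.mpr hc).le, inv_inv]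

/-- **`s(tanh t · u²) = rot u · a_t · rot u⁻¹`**: the section at `tanh t · u²` is the `K`-conjugate
of `a_t` by `rot u`. -/
theorem sec_tanh_mul_sq (t : ℝ) (u : Circle) :
    sec ((Real.tanh t : ℂ) * ((u : ℂ) ^ 2)) = rot u * hyp t * rot u⁻¹ := by
  apply ext_mat
  have hb : (Real.tanh t : ℂ) * ((u : ℂ) ^ 2) ∈ ball (0 : ℂ) 1 := by
    rw [mem_ball_zero_iff, norm_mul, norm_pow, Circle.norm_coe, one_pow, mul_one, Complex.norm_real,
      Real.norm_eq_abs]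
    exact Real.abs_tanh_lt_one t
  have hr : rad ((Real.tanh t : ℂ) * ((u : ℂ) ^ 2)) = Real.cosh t := by
    have := rad_tanh_mul t (u ^ 2)
    rwa [Circle.coe_pow] at this
  rw [show mat (sec ((Real.tanh t : ℂ) * ((u : ℂ) ^ 2))) = su11 (rad ((Real.tanh t : ℂ) * ((u : ℂ) ^ 2)) : ℂ)
      ((rad ((Real.tanh t : ℂ) * ((u : ℂ) ^ 2)) : ℂ) * clamp ((Real.tanh t : ℂ) * ((u : ℂ) ^ 2)))
      from coe_toSU11 _ _ _, clamp_of_mem_ball hb, hr, mat_rot_mul_hyp_mul_rot,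
    Circle.coe_inv_eq_conj, Complex.conj_conj, Complex.mul_conj, Complex.normSq_eq_norm_sq,
    Circle.norm_coe]
  have hc : (Real.cosh t : ℂ) ≠ 0 := by exact_mod_cast (Real.cosh_pos t).ne'
  congr 1
  · push_cast
    ring
  · rw [Real.tanh_eq_sinh_div_cosh, Complex.ofReal_div]
    field_simp

/-- **`s(tanh t · e^{iθ}) = rot (e^{iθ/2}) · a_t · rot (e^{iθ/2})⁻¹`** — Rühl's coordinate point. -/
theorem sec_tanh_exp (t θ : ℝ) :
    sec ((Real.tanh t : ℂ) * ((Real.cos θ : ℂ) + (Real.sin θ : ℂ) * I)) =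
      rot (Circle.exp (θ / 2)) * hyp t * rot (Circle.exp (θ / 2))⁻¹ := by
  have h : ((Circle.exp (θ / 2) : Circle) : ℂ) ^ 2 = (Real.cos θ : ℂ) + (Real.sin θ : ℂ) * I := by
    rw [Circle.coe_exp, ← Complex.exp_nat_mul,
      show ((2 : ℕ) : ℂ) * (((θ / 2 : ℝ) : ℂ) * I) = (θ : ℂ) * I by push_cast; ring,
      Complex.exp_mul_I, ← Complex.ofReal_cos, ← Complex.ofReal_sin]
  rw [← h]
  exact sec_tanh_mul_sq t (Circle.exp (θ / 2))

/-- A bi-`K`-invariant function is constant on the `K`-orbits of Rühl's coordinates: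
`f (s(tanh t · e^{iθ}) · rot w) = f (a_t)`. -/
theorem biRotInvariant_sec_tanh_exp {E : Type*} {f : SU11 → E}
    (hf : ∀ (u v : Circle) (g : SU11), f (rot u * g * rot v) = f g) (t θ : ℝ) (w : Circle) :
    f (sec ((Real.tanh t : ℂ) * ((Real.cos θ : ℂ) + (Real.sin θ : ℂ) * I)) * rot w) = f (hyp t) := by
  rw [sec_tanh_exp, mul_assoc, ← map_mul]
  exact hf _ _ _

/-! ### The spherical integration formula -/

/-- An integral over `(0, ∞) × (-π, π)` of a function of the first variable alone:
`∫_{(0,∞)×(-π,π)} G(t) = 2π • ∫_0^∞ G(t) dt` (no integrability hypothesis). -/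
theorem integral_Ioi_prod_Ioo_fst {E : Type*} [NormedAddCommGroup E] [NormedSpace ℝ E]
    (G : ℝ → E) :
    ∫ p in Ioi (0 : ℝ) ×ˢ Ioo (-π) π, G p.1 = (2 * π) • ∫ t in Ioi (0 : ℝ), G t := by
  have e1 : (volume : Measure (ℝ × ℝ)).restrict (Ioi (0 : ℝ) ×ˢ Ioo (-π) π) =
      (volume.restrict (Ioi (0 : ℝ))).prod (volume.restrict (Ioo (-π) π)) :=
    (Measure.prod_restrict _ _).symm
  have e2 : (volume.restrict (Ioi (0 : ℝ))).prod (volume.restrict (Ioo (-π) π)) =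
      Measure.map Prod.swap ((volume.restrict (Ioo (-π) π)).prod (volume.restrict (Ioi (0 : ℝ)))) :=
    (Measure.prod_swap).symm
  rw [e1, e2, show (Prod.swap : ℝ × ℝ → ℝ × ℝ) = ⇑(MeasurableEquiv.prodComm : ℝ × ℝ ≃ᵐ ℝ × ℝ)
    from rfl, MeasurableEquiv.prodComm.measurableEmbedding.integral_map]
  have e3 : ∫ p, G (MeasurableEquiv.prodComm p).1
      ∂((volume.restrict (Ioo (-π) π)).prod (volume.restrict (Ioi (0 : ℝ)))) =
      ∫ p, (1 : ℝ) • G p.2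
      ∂((volume.restrict (Ioo (-π) π)).prod (volume.restrict (Ioi (0 : ℝ)))) := by
    congr 1
    funext p
    rw [one_smul]
    rfl
  rw [e3, integral_prod_smul (fun _ : ℝ => (1 : ℝ)) G, integral_const, measureReal_def,
    Measure.restrict_apply_univ, Real.volume_Ioo, ENNReal.toReal_ofReal (by linarith [Real.pi_pos]),
    smul_eq_mul, mul_one, show π - -π = 2 * π by ring]

section measure

variable [MeasurableSpace Circle] [BorelSpace Circle]

/-- **The spherical integration formula**: for every Haar measure `μ` of `SU(1,1)` and every
`μ`-integrable bi-`K`-invariant `f`, with `c = haarScalarFactor (nu haarCircle) μ > 0`,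
`c • ∫_G f dμ = 2π • ∫_0^∞ (sinh t cosh t) • f (a_t) dt`. -/
theorem integral_biRotInvariant (μ : Measure SU11) [IsHaarMeasure μ] {E : Type*}
    [NormedAddCommGroup E] [NormedSpace ℝ E] [CompleteSpace E] {f : SU11 → E}
    (hf : Integrable f μ) (hK : ∀ (u v : Circle) (g : SU11), f (rot u * g * rot v) = f g) :
    (haarScalarFactor (nu haarCircle) μ : ℝ) • ∫ g, f g ∂μ =
      (2 * π) • ∫ t in Ioi (0 : ℝ), (Real.sinh t * Real.cosh t) • f (hyp t) := by
  rw [integral_eq_cartan μ f hf]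
  have h : ∀ p : ℝ × ℝ, (Real.sinh p.1 * Real.cosh p.1) •
      ((2 * π)⁻¹ • ∫ ψ in (0 : ℝ)..2 * π,
        f (sec ((Real.tanh p.1 : ℂ) * ((Real.cos p.2 : ℂ) + (Real.sin p.2 : ℂ) * I)) *
          rot (Circle.exp ψ))) = (Real.sinh p.1 * Real.cosh p.1) • f (hyp p.1) := by
    intro p
    simp only [biRotInvariant_sec_tanh_exp hK]
    rw [intervalIntegral.integral_const, sub_zero, smul_smul, smul_smul, mul_assoc,
      inv_mul_cancel₀ (by positivity), mul_one]
  simp only [h]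
  exact integral_Ioi_prod_Ioo_fst fun t => (Real.sinh t * Real.cosh t) • f (hyp t)

/-- **The spherical integration formula, `sinh 2t` form**:
`c • ∫_G f dμ = π • ∫_0^∞ sinh(2t) • f (a_t) dt`. -/
theorem integral_biRotInvariant' (μ : Measure SU11) [IsHaarMeasure μ] {E : Type*}
    [NormedAddCommGroup E] [NormedSpace ℝ E] [CompleteSpace E] {f : SU11 → E}
    (hf : Integrable f μ) (hK : ∀ (u v : Circle) (g : SU11), f (rot u * g * rot v) = f g) :
    (haarScalarFactor (nu haarCircle) μ : ℝ) • ∫ g, f g ∂μ =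
      π • ∫ t in Ioi (0 : ℝ), Real.sinh (2 * t) • f (hyp t) := by
  rw [integral_biRotInvariant μ hf hK, ← integral_smul, ← integral_smul]
  congr 1
  funext t
  rw [smul_smul, smul_smul, Real.sinh_two_mul]
  congr 1
  ring

/-- **The spherical integration formula for `ν = nu haarCircle`** (`c = 1`):
`∫_G f dν = 2π • ∫_0^∞ (sinh t cosh t) • f (a_t) dt`. -/
theorem integral_nu_biRotInvariant {E : Type*} [NormedAddCommGroup E] [NormedSpace ℝ E]
    [CompleteSpace E] {f : SU11 → E} (hf : Integrable f (nu haarCircle))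
    (hK : ∀ (u v : Circle) (g : SU11), f (rot u * g * rot v) = f g) :
    ∫ g, f g ∂(nu haarCircle) =
      (2 * π) • ∫ t in Ioi (0 : ℝ), (Real.sinh t * Real.cosh t) • f (hyp t) := by
  have h := integral_biRotInvariant (nu haarCircle) hf hK
  rwa [haarScalarFactor_self, NNReal.coe_one, one_smul] at h

end measure

end Summit.Ventures.HodgeRepro2.T5SU11SphericalIntegral
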